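/-
Copyright (c) 2026. All rights reserved.
Released under Apache 2.0 license as described in the file LICENSE.
-/
import Mathlib
import HarnessLib
import Summits.RiemannHypothesis.RiemannHypothesis.Theorems.EarlyAppointmentsRoucheAux
import Summits.RiemannHypothesis.RiemannHypothesis.Theorems.EarlyAppointmentsCombGHelpers
import Summits.RiemannHypothesis.RiemannHypothesis.Theorems.EarlyAppointmentsCriticalPointRouche

/-!
# Critical point from zero of h

If h(w) = 1 + (w - c)G(w) = 0 and f(w) ≠ 0 and w ≠ c, then f'(w) = 0.
-/

open Complex Real Set Filter Topology Metric
open scoped BigOperators Topology ComplexConjugate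

noncomputable section

namespace CriticalPointFromZero

/-- If w is in D(c, h/2), then w.im > h/2. -/
theorem im_pos_in_disc {x₀ h : ℝ} (_hh : 0 < h) (w : ℂ) (hw_in : ‖w - ((x₀ : ℂ) + h * I)‖ < h / 2) :
    w.im > h / 2 := by
  -- |w.im - h| ≤ ‖w - c‖ < h/2
  have him : |w.im - h| ≤ ‖w - ((x₀ : ℂ) + h * I)‖ := by
    have h1 : (w - ((x₀ : ℂ) + h * I)).im = w.im - h := by simp
    have h2 : |w.im - h| = |(w - ((x₀ : ℂ) + h * I)).im| := by rw [h1]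
    rw [h2]
    exact Complex.abs_im_le_norm _
  have him' : |w.im - h| < h / 2 := lt_of_le_of_lt him hw_in
  have habs := abs_lt.mp him'
  linarith [habs.1]

/-- If w is in D(c, h/2) with 8h ≤ R, then ‖w - x₀‖ < R. -/
theorem in_R_ball {x₀ h R : ℝ} (hh : 0 < h) (hhR : 8 * h ≤ R) (w : ℂ)
    (hw_in : ‖w - ((x₀ : ℂ) + h * I)‖ < h / 2) :
    ‖w - (x₀ : ℂ)‖ < R := by
  have hc_dist : ‖((x₀ : ℂ) + h * I) - (x₀ : ℂ)‖ = h := by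
    have hcx : ((x₀ : ℂ) + h * I) - (x₀ : ℂ) = h * I := by ring
    rw [hcx, norm_mul, Complex.norm_I, mul_one, Complex.norm_real, Real.norm_eq_abs, abs_of_pos hh]
  calc ‖w - (x₀ : ℂ)‖ = ‖(w - ((x₀ : ℂ) + h * I)) + (((x₀ : ℂ) + h * I) - (x₀ : ℂ))‖ := by ring_nf
    _ ≤ ‖w - ((x₀ : ℂ) + h * I)‖ + ‖((x₀ : ℂ) + h * I) - (x₀ : ℂ)‖ := norm_add_le _ _
    _ < h / 2 + h := by linarith [hw_in, hc_dist]
    _ = 3 * h / 2 := by ring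
    _ < R := by linarith

/-- conj(c) is outside D(c, h/2): ‖conj(c) - c‖ = 2h > h/2. -/
theorem conj_outside_disc {x₀ h : ℝ} (hh : 0 < h) :
    ‖((x₀ : ℂ) - h * I) - ((x₀ : ℂ) + h * I)‖ > h / 2 := by
  have hdiff : ((x₀ : ℂ) - h * I) - ((x₀ : ℂ) + h * I) = -2 * h * I := by ring
  rw [hdiff]
  rw [show (-2 : ℂ) * h * I = ((-2 * h : ℝ) : ℂ) * I by push_cast; ring]
  rw [norm_mul, Complex.norm_I, mul_one, Complex.norm_real, Real.norm_eq_abs]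
  have h2h : |-2 * h| = 2 * h := by
    rw [show (-2 : ℝ) * h = -(2 * h) by ring, abs_neg, abs_of_pos (by linarith)]
  rw [h2h]
  linarith

/-- In D(c, h/2), the only potential zero with non-real part is c itself. -/
theorem zero_in_disc_is_c {f : ℂ → ℂ} {x₀ h R : ℝ} (hh : 0 < h) (_hR : 0 < R) (hhR : 8 * h ≤ R)
    (honly_pair : ∀ w : ℂ, ‖w - (x₀ : ℂ)‖ < R → f w = 0 → w.im ≠ 0 →
      (w = (x₀ : ℂ) + h * I ∨ w = (x₀ : ℂ) - h * I))
    (w : ℂ) (hw_in : ‖w - ((x₀ : ℂ) + h * I)‖ < h / 2) (hw_zero : f w = 0) :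
    w = (x₀ : ℂ) + h * I := by
  -- w.im > h/2 > 0
  have hw_im_pos : w.im > h / 2 := im_pos_in_disc hh w hw_in
  have hw_im_ne : w.im ≠ 0 := by linarith
  -- ‖w - x₀‖ < R
  have hw_in_R : ‖w - (x₀ : ℂ)‖ < R := in_R_ball hh hhR w hw_in
  -- By honly_pair
  have hor := honly_pair w hw_in_R hw_zero hw_im_ne
  cases hor with
  | inl h => exact h
  | inr h_conj =>
    -- w = conj(c) = x₀ - h*I, but ‖conj(c) - c‖ = 2h > h/2
    have h_dist : ‖w - ((x₀ : ℂ) + h * I)‖ = 2 * h := by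
      rw [h_conj]
      have hdiff : ((x₀ : ℂ) - h * I) - ((x₀ : ℂ) + h * I) = -2 * h * I := by ring
      rw [hdiff]
      rw [show (-2 : ℂ) * h * I = ((-2 * h : ℝ) : ℂ) * I by push_cast; ring]
      rw [norm_mul, Complex.norm_I, mul_one, Complex.norm_real, Real.norm_eq_abs]
      rw [show |-2 * h| = 2 * h by rw [show (-2 : ℝ) * h = -(2 * h) by ring, abs_neg, abs_of_pos (by linarith)]]
    -- But we have ‖w - c‖ < h/2
    linarith [hw_in]

/-- h(c) = 1. -/
theorem h_at_c {f : ℂ → ℂ} {x₀ h : ℝ} :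
    CriticalPointRouche.h f ((x₀ : ℂ) + h * I) ((x₀ : ℂ) + h * I) = 1 := by
  unfold CriticalPointRouche.h
  simp [sub_self]

/-- w ≠ c if h(w) = 0. -/
theorem w_ne_c_at_h_zero {f : ℂ → ℂ} {x₀ h : ℝ}
    (w : ℂ) (hw_h_zero : CriticalPointRouche.h f ((x₀ : ℂ) + h * I) w = 0) :
    w ≠ (x₀ : ℂ) + h * I := by
  intro heq
  rw [heq, h_at_c] at hw_h_zero
  exact one_ne_zero hw_h_zero

/-- If f(w) = 0 and w ∈ D(c, h/2), then w = c. Therefore, if h(w) = 0, then f(w) ≠ 0. -/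
theorem f_nonzero_at_h_zero {f : ℂ → ℂ} {x₀ h R : ℝ} (hh : 0 < h) (hR : 0 < R) (hhR : 8 * h ≤ R)
    (honly_pair : ∀ w : ℂ, ‖w - (x₀ : ℂ)‖ < R → f w = 0 → w.im ≠ 0 →
      (w = (x₀ : ℂ) + h * I ∨ w = (x₀ : ℂ) - h * I))
    (w : ℂ) (hw_in : ‖w - ((x₀ : ℂ) + h * I)‖ < h / 2)
    (hw_h_zero : CriticalPointRouche.h f ((x₀ : ℂ) + h * I) w = 0) :
    f w ≠ 0 := by
  intro hfw
  -- If f(w) = 0 and w ∈ D(c, h/2), then w = c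
  have hw_eq_c := zero_in_disc_is_c hh hR hhR honly_pair w hw_in hfw
  -- But w ≠ c since h(w) = 0 and h(c) = 1
  have hw_ne_c := w_ne_c_at_h_zero w hw_h_zero
  exact hw_ne_c hw_eq_c

/-- Main lemma: if h(w) = 0, then f'(w) = 0.

The key steps:
1. h(w) = 0 ⟹ 1 + (w-c)G(w) = 0 ⟹ G(w) = -1/(w-c)
2. w ≠ c (since h(c) = 1 ≠ 0)
3. f(w) ≠ 0 (since the only zeros in D(c, h/2) with Im ≠ 0 would have to be c)
4. By G_eq_logDeriv_sub: G(w) = f'/f - 1/(w-c)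
5. So f'/f = 0 ⟹ f' = 0
-/
theorem deriv_f_zero_of_h_zero {f : ℂ → ℂ} {x₀ h R : ℝ}
    (hf_diff : Differentiable ℂ f)
    (hh : 0 < h) (hR : 0 < R) (hhR : 8 * h ≤ R)
    (hz₀ : f ((x₀ : ℂ) + h * I) = 0)
    (honly_pair : ∀ w : ℂ, ‖w - (x₀ : ℂ)‖ < R → f w = 0 → w.im ≠ 0 →
      (w = (x₀ : ℂ) + h * I ∨ w = (x₀ : ℂ) - h * I))
    (w : ℂ) (hw_in : ‖w - ((x₀ : ℂ) + h * I)‖ < h / 2)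
    (hw_h_zero : CriticalPointRouche.h f ((x₀ : ℂ) + h * I) w = 0) :
    deriv f w = 0 := by
  -- Step 1: w ≠ c
  have hw_ne_c : w ≠ (x₀ : ℂ) + h * I := w_ne_c_at_h_zero w hw_h_zero
  -- Step 2: f(w) ≠ 0
  have hfw_ne : f w ≠ 0 := f_nonzero_at_h_zero hh hR hhR honly_pair w hw_in hw_h_zero
  -- Step 3: From h(w) = 0, get G(w) = -1/(w-c)
  have hG_eq : RoucheAux.G f ((x₀ : ℂ) + h * I) w = -1 / (w - ((x₀ : ℂ) + h * I)) := by
    unfold CriticalPointRouche.h at hw_h_zero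
    have hw_sub_c_ne : w - ((x₀ : ℂ) + h * I) ≠ 0 := sub_ne_zero.mpr hw_ne_c
    have h1 : (w - ((x₀ : ℂ) + h * I)) * RoucheAux.G f ((x₀ : ℂ) + h * I) w = -1 := by
      have h0 : 1 + (w - ((x₀ : ℂ) + h * I)) * RoucheAux.G f ((x₀ : ℂ) + h * I) w = 0 := hw_h_zero
      calc (w - ((x₀ : ℂ) + h * I)) * RoucheAux.G f ((x₀ : ℂ) + h * I) w
          = (w - ((x₀ : ℂ) + h * I)) * RoucheAux.G f ((x₀ : ℂ) + h * I) w + 1 - 1 := by ring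
        _ = 0 - 1 := by rw [add_comm, h0]
        _ = -1 := by ring
    field_simp [hw_sub_c_ne] at h1 ⊢
    exact h1
  -- Step 4: Use G_eq_logDeriv_sub to get f'/f = 0
  -- Note: RoucheAux.G = EarlyAppointmentsCombGHelpers.G
  have hG_logDeriv := EarlyAppointmentsCombGHelpers.G_eq_logDeriv_sub hf_diff hz₀ hw_ne_c hfw_ne
  -- G(w) = f'/f - 1/(w-c) and G(w) = -1/(w-c)
  -- So f'/f = G(w) + 1/(w-c) = -1/(w-c) + 1/(w-c) = 0
  have h_f_div : deriv f w / f w = 0 := by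
    unfold RoucheAux.G at hG_eq
    have h1 : deriv f w / f w - 1 / (w - ((x₀ : ℂ) + h * I)) = -1 / (w - ((x₀ : ℂ) + h * I)) := by
      rw [← hG_logDeriv]
      exact hG_eq
    have hw_sub_c_ne : w - ((x₀ : ℂ) + h * I) ≠ 0 := sub_ne_zero.mpr hw_ne_c
    have h2 : deriv f w / f w = -1 / (w - ((x₀ : ℂ) + h * I)) + 1 / (w - ((x₀ : ℂ) + h * I)) := by
      calc deriv f w / f w
          = deriv f w / f w - 1 / (w - ((x₀ : ℂ) + h * I)) + 1 / (w - ((x₀ : ℂ) + h * I)) := by ring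
        _ = -1 / (w - ((x₀ : ℂ) + h * I)) + 1 / (w - ((x₀ : ℂ) + h * I)) := by rw [h1]
    rw [h2]
    ring
  -- Step 5: f'/f = 0 and f(w) ≠ 0 ⟹ f' = 0
  have h_deriv : deriv f w = f w * (deriv f w / f w) := by
    field_simp [hfw_ne]
  rw [h_deriv, h_f_div, mul_zero]

end CriticalPointFromZero

end
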